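import Mathlib.Data.Real.Basic
import Mathlib.Tactic.Ring
import Mathlib.Tactic.Linarith

/-!
# Stub `stub_subharmonicDecay` (D3) of line `determinant-tilt`
(crux `Summit.QuantumFields.QCD.Theses.SpectralDefectExtinction.ExtinctionBuildsQCD`, item stmt-QuantumFields-18064,
skeleton v9)

SUBHARMONICITY ⇒ EXPONENTIAL DECAY, abstract form. On an index type `ι` with an `ℕ`-valued "distance" `dist`
satisfying the triangle inequality, let `f : ι → ℝ` be bounded above by `M` and let `0 ≤ b`. If every point `i`
farther than `ℓ` from `y` admits a point `u` within `ℓ + 1` of `i` with `f i ≤ b * f u`, then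
`f i ≤ M * b ^ (dist i y / (ℓ + 1))` for every `i` (natural-number division).

This is the iteration step of the single-scale fractional-moment criterion (Aizenman–Schenker–Friedrich–Hundertmark
2001, §3): there `f i = E|G(i,y)|^s` satisfies `f i ≤ Σ_u K(i,u) f u` with `Σ_u K(i,u) ≤ b` over `u` in the
boundary layers of the ball `B(i,ℓ)`, and `u` is taken to be the maximiser.

Proof: by induction on `n` one shows `n ≤ dist i y / (ℓ + 1) → f i ≤ M * b ^ n` for all `i`; the step uses
`(n+1)(ℓ+1) ≤ dist i y ≤ dist i u + dist u y ≤ (ℓ+1) + dist u y`, whence `n (ℓ+1) ≤ dist u y`, the induction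
hypothesis at `u`, and `f i ≤ b * f u ≤ b * (M * b ^ n)` (monotonicity of multiplication by `b ≥ 0`).
Neither `b ≤ 1`, nor `0 ≤ f`, nor `0 ≤ M` is needed.

Mathlib only; no named facts are used.
-/

namespace Summit.QuantumFields.QCD.Cruxes.ExtinctionBuildsQCD.DeterminantTilt

/-- **Stub D3 (`stub_subharmonicDecay`) — SUBHARMONICITY ⇒ EXPONENTIAL DECAY (ABSTRACT).** On an index type with
an `ℕ`-valued "distance" satisfying the triangle inequality, let `f` be bounded by `M` and `b ≥ 0`; if every point `i`
farther than `ℓ` from `y` has a point `u` within `ℓ + 1` of `i` with `f i ≤ b · f u`, then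
`f i ≤ M · b^{⌊dist(i,y)/(ℓ+1)⌋}` for every `i`. Proof: induction on `n ≤ dist(i,y)/(ℓ+1)`
(`dist(u,y) ≥ dist(i,y) − (ℓ+1)`). [cite: AizenmanEtAl2001, §3 (iteration of the finite-volume criterion)] [folklore] -/
theorem stub_subharmonicDecay :
    ∀ {ι : Type} (dist : ι → ι → ℕ), (∀ i j l, dist i l ≤ dist i j + dist j l) →
      ∀ (f : ι → ℝ) (y : ι) (ℓ : ℕ) (b M : ℝ), 0 ≤ b → (∀ i, f i ≤ M) →
      (∀ i, ℓ < dist i y → ∃ u, dist i u ≤ ℓ + 1 ∧ f i ≤ b * f u) →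
      ∀ i, f i ≤ M * b ^ (dist i y / (ℓ + 1)) := by
  intro ι dist htri f y ℓ b M hb hM hsub
  have hpos : 0 < ℓ + 1 := Nat.succ_pos ℓ
  -- the claim for every admissible exponent `n ≤ dist i y / (ℓ + 1)`, by induction on `n`, uniformly in `i`
  have key : ∀ n : ℕ, ∀ i, n ≤ dist i y / (ℓ + 1) → f i ≤ M * b ^ n := by
    intro n
    induction n with
    | zero =>
      intro i _
      simpa using hM i
    | succ n ih =>
      intro i hi
      -- `(n + 1) * (ℓ + 1) ≤ dist i y`, in particular `ℓ < dist i y`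
      have h1 : (n + 1) * (ℓ + 1) ≤ dist i y := (Nat.le_div_iff_mul_le hpos).mp hi
      have h1' : n * (ℓ + 1) + (ℓ + 1) ≤ dist i y := by rwa [Nat.add_one_mul] at h1
      have hℓ : ℓ < dist i y := by omega
      obtain ⟨u, hu, hfu⟩ := hsub i hℓ
      -- triangle inequality: `n * (ℓ + 1) ≤ dist u y`, so the induction hypothesis applies at `u`
      have h2 : n * (ℓ + 1) ≤ dist u y := by
        have h3 := htri i u y
        omega
      have h4 : f u ≤ M * b ^ n := ih u ((Nat.le_div_iff_mul_le hpos).mpr h2)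
      calc f i ≤ b * f u := hfu
        _ ≤ b * (M * b ^ n) := mul_le_mul_of_nonneg_left h4 hb
        _ = M * b ^ (n + 1) := by ring
  intro i
  exact key _ i le_rfl

end Summit.QuantumFields.QCD.Cruxes.ExtinctionBuildsQCD.DeterminantTilt
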